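import Summits.FinalStateConjecture.FinalStateConjecture.Theorems.PhotonSphereChannelsWindowedShellChannelsGlueCorePair

/-!
# Crux `WindowedShellChannels` (stmt-FinalStateConjecture-14085), line `Sketch` — glue core, part 2
# (the composition inequality for a general potential)

The potential-independent heart of `stub_glue` (skeleton v8, lead c3).  For a differentiable `V ≥ 0`,
a window edge `a`, two finite-energy solutions `z` ("zone", data in `(−∞, Az)`) and `f` ("far", data in
`(Bf, ∞)`) whose supports have not met by the time `T` (`Az + T < Bf − T`), the weighted PSD-subadditivity
of the windowed drop (`hD`, the registered `stub_dropPSD`) and a late-drop bound for `z` at time `T`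
(`farEnergy V a z T ≤ farChannelEnergy V a z atTop + εE(z)`) give, for every later time `t ≥ T`,

  `farEnergy V a f t + farEnergy V a z t ≤ farEnergy V a (z + f) t + η·E(f) + (ε/η)·E(z)`

(`far_pair_lower`): interference between the two pieces in the far window costs only `ηE(f) + (ε/η)E(z)`.
Applied on the far side and on the reflected near side and combined with `LostPSD.lostPSD` for the small
gap piece, this yields the composition inequality `glue_core`.  No definitions. [folklore]
-/

noncomputable section

set_option linter.dupNamespace false

open Set Filter Topology Function MeasureTheory
open scoped ENNReal

namespace Summit.FinalStateConjecture.FinalStateConjecture.Theorems.WindowedShellChannelsSketch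

open Literature.Geometry.Lorentzian Literature.Geometry.Lorentzian.ReggeWheeler
open Summit.FinalStateConjecture.FinalStateConjecture.Theorems
open Summit.FinalStateConjecture.FinalStateConjecture.Theorems.CauchyWaveGlobal

namespace Glue

/-- **The composition inequality** (general potential).  See `stub_glue` in the skeleton for the roles
of the pieces: `z` zone, `n` near, `f` far, `g` gap; `H ≥ 0` is the lag of the window edge `−H`;
`Tf`, `Tn` are the separation times on the far side and on the reflected near side. [folklore] -/
theorem glue_core {V : ℝ → ℝ} (hV : Differentiable ℝ V) (hV0 : ∀ x, 0 ≤ V x)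
    (hD : ∀ (V : ℝ → ℝ), Differentiable ℝ V → (∀ x, 0 ≤ V x) →
      ∀ u v : ℝ → ℝ → ℝ, IsSolution V u → IsSolution V v → totalEnergy V u 0 ≠ ⊤ → totalEnergy V v 0 ≠ ⊤ →
      ∀ a η T t : ℝ, 0 < η → 0 ≤ T → T ≤ t →
        farEnergy V a (fun t x => u t x + v t x) T
            + ENNReal.ofReal (1 + η) * farEnergy V a u t + ENNReal.ofReal (1 + η⁻¹) * farEnergy V a v t
          ≤ farEnergy V a (fun t x => u t x + v t x) t
            + ENNReal.ofReal (1 + η) * farEnergy V a u T + ENNReal.ofReal (1 + η⁻¹) * farEnergy V a v T)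
    {ψ z n f g : ℝ → ℝ → ℝ} (hψ : IsSolution V ψ) (hz : IsSolution V z) (hn : IsSolution V n)
    (hf : IsSolution V f) (hg : IsSolution V g) (hsum : ∀ t x, ψ t x = z t x + n t x + f t x + g t x)
    (hEψ : totalEnergy V ψ 0 ≠ ⊤) (hEz : totalEnergy V z 0 ≠ ⊤) (hEn : totalEnergy V n 0 ≠ ⊤)
    (hEf : totalEnergy V f 0 ≠ ⊤) (hEg : totalEnergy V g 0 ≠ ⊤)
    {Az Bn Bf H Tf Tn : ℝ} (hH : 0 ≤ H) (hAz : 0 ≤ Az) (hAzBf : Az ≤ Bf)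
    (hsz : CauchyDataSupportedOn z (Iio Az)) (hszr : CauchyDataSupportedOn (fun t x => z t (-x)) (Iio Az))
    (hszf : CauchyDataSupportedOn z (Ioi (-Az)))
    (hsn : CauchyDataSupportedOn n (Iio (-Bn))) (hsf : CauchyDataSupportedOn f (Ioi Bf))
    (hTf : H ≤ Tf) (hTn : H ≤ Tn) (hsepf : Az + Tf < Bf - Tf) (hsepn : Az + Tn < Bn - Tn)
    {c cF cN ε η δ : ℝ} (hc : 0 ≤ c) (hc1 : c ≤ 1) (hcF : 0 ≤ cF) (hcN : 0 ≤ cN) (hε : 0 ≤ ε)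
    (hη : 0 < η) (hδ : 0 ≤ δ)
    (SZ : ENNReal.ofReal c * totalEnergy V z 0 ≤ channelEnergy V 0 (-H) z atTop)
    (SF : ENNReal.ofReal cF * totalEnergy V f 0 ≤ farChannelEnergy V (-H) f atTop)
    (SN : ENNReal.ofReal cN * totalEnergy V n 0
      ≤ farChannelEnergy (fun x => V (-x)) (-H) (fun t x => n t (-x)) atTop)
    (LF : farEnergy V (-H) z Tf ≤ farChannelEnergy V (-H) z atTop + ENNReal.ofReal ε * totalEnergy V z 0)
    (LN : farEnergy (fun x => V (-x)) (-H) (fun t x => z t (-x)) Tn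
      ≤ farChannelEnergy (fun x => V (-x)) (-H) (fun t x => z t (-x)) atTop
        + ENNReal.ofReal ε * totalEnergy (fun x => V (-x)) (fun t x => z t (-x)) 0)
    (hEsum : totalEnergy V z 0 + totalEnergy V n 0 + totalEnergy V f 0
      ≤ ENNReal.ofReal (1 + δ) * totalEnergy V ψ 0)
    (hEg' : totalEnergy V g 0 ≤ ENNReal.ofReal δ * totalEnergy V ψ 0) :
    ENNReal.ofReal (1 - (1 + η) * ((1 - min c (min cF cN)) + η + 2 * ε / η) * (1 + δ) - (1 + η⁻¹) * δ)
        * totalEnergy V ψ 0 ≤ channelEnergy V 0 (-H) ψ atTop := by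
  -- the reflected potential
  have hVr : Differentiable ℝ (fun x => V (-x)) := hV.comp differentiable_neg
  have hVr0 : ∀ x, 0 ≤ V (-x) := fun x => hV0 _
  -- the composite pieces
  set A : ℝ → ℝ → ℝ := fun t x => z t x + n t x + f t x with hA
  have hzf : IsSolution V (fun t x => z t x + f t x) := by
    have h := isSolution_lincomb hz hf 1 1; simp only [one_mul] at h; exact h
  have hAsol : IsSolution V A := by
    have h := isSolution_lincomb hzf hn 1 1
    simp only [one_mul] at h
    have hfun : (fun t x => z t x + f t x + n t x) = A := by funext τ y; simp only [hA]; ring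
    rwa [hfun] at h
  have hψA : ψ = fun t x => g t x + A t x := by
    funext τ y; rw [hsum τ y]; simp only [hA]; ring
  have hEzf : totalEnergy V (fun t x => z t x + f t x) 0 ≠ ⊤ := totalEnergy_add_ne_top hV hV0 hz hf hEz hEf
  -- total energy of `A`
  have hszfS : CauchyDataSupportedOn (fun t x => z t x + f t x) (Ioi (-Az)) :=
    supported_add hz.1 hf.1 hszf (supported_mono hsf (Ioi_subset_Ioi (by linarith)))
  have hEA : totalEnergy V A 0 = totalEnergy V z 0 + totalEnergy V n 0 + totalEnergy V f 0 := by
    have h1 : A = fun t x => n t x + (z t x + f t x) := by funext τ y; simp only [hA]; ring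
    rw [h1, NearFarAdditivity.totalEnergy_add_eq hV hV0 hn hzf hsn hszfS (by linarith),
      NearFarAdditivity.totalEnergy_add_eq hV hV0 hz hf hsz hsf hAzBf]
    ring
  have hEAfin : totalEnergy V A 0 ≠ ⊤ := by
    rw [hEA]; exact ENNReal.add_ne_top.2 ⟨ENNReal.add_ne_top.2 ⟨hEz, hEn⟩, hEf⟩
  -- Step 1: the gap piece costs little (`lostPSD` with ψ₁ = g, ψ₂ = A)
  have hI := LostPSD.lostPSD hV hV0 hg hAsol hη 0 (-H)
  rw [← hψA] at hI
  -- Step 2: eventually, the exterior energy of `A` dominates the shares up to the interference cost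
  set S : ℝ≥0∞ := ENNReal.ofReal η * totalEnergy V f 0 + ENNReal.ofReal (ε / η) * totalEnergy V z 0
    + (ENNReal.ofReal η * totalEnergy V n 0 + ENNReal.ofReal (ε / η) * totalEnergy V z 0) with hS
  set X : ℝ≥0∞ := ENNReal.ofReal c * totalEnergy V z 0 + ENNReal.ofReal cF * totalEnergy V f 0
    + ENNReal.ofReal cN * totalEnergy V n 0 with hX
  have hII : X ≤ channelEnergy V 0 (-H) A atTop + S := by
    refine LostPSD.le_channelEnergy_add_of_eventually_le ?_
    filter_upwards [eventually_ge_atTop (max Tf Tn)] with t ht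
    have htf : Tf ≤ t := le_of_max_le_left ht
    have htn : Tn ≤ t := le_of_max_le_right ht
    have ht0 : 0 ≤ t := hH.trans (hTf.trans htf)
    have hat : 0 ≤ -H + |t| := by rw [abs_of_nonneg ht0]; linarith
    -- (a) split the exterior energy of `A`
    have hsplitA := exteriorEnergy_eq_far_add_reflect hAsol (a := -H) hat
    -- (b) far side: `n` is invisible
    have hfarA : farEnergy V (-H) A t = farEnergy V (-H) (fun t x => z t x + f t x) t := by
      have h1 : A = fun t x => (z t x + f t x) + n t x := by funext τ y; simp only [hA]; ring
      rw [h1]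
      exact farEnergy_add_near_eq hV hV0 hzf hn hsn (by linarith) t
    -- (c) reflected side: `f` is invisible
    have hzr : IsSolution (fun x => V (-x)) (fun t x => z t (-x)) := isSolution_reflect hz
    have hnr : IsSolution (fun x => V (-x)) (fun t x => n t (-x)) := isSolution_reflect hn
    have hfr : IsSolution (fun x => V (-x)) (fun t x => f t (-x)) := isSolution_reflect hf
    have hznr : IsSolution (fun x => V (-x)) (fun t x => z t (-x) + n t (-x)) := by
      have h := isSolution_lincomb hzr hnr 1 1; simp only [one_mul] at h; exact h
    have hfarAr : farEnergy (fun x => V (-x)) (-H) (fun t x => A t (-x)) t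
        = farEnergy (fun x => V (-x)) (-H) (fun t x => z t (-x) + n t (-x)) t := by
      have h1 : (fun t x => A t (-x)) = fun t x => (z t (-x) + n t (-x)) + f t (-x) := by
        funext τ y; simp only [hA]
      rw [h1]
      exact farEnergy_add_near_eq hVr hVr0 hznr hfr (supported_reflect_Ioi hsf) (by linarith) t
    -- (d) interference bounds on both sides
    have hpf := far_pair_lower hV hV0 hD hz hf hEz hEf hsz hsf (hH.trans hTf) hsepf hη hε LF htf
    have hEzr : totalEnergy (fun x => V (-x)) (fun t x => z t (-x)) 0 ≠ ⊤ := by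
      rwa [totalEnergy_reflect hz]
    have hEnr : totalEnergy (fun x => V (-x)) (fun t x => n t (-x)) 0 ≠ ⊤ := by
      rwa [totalEnergy_reflect hn]
    have hpn := far_pair_lower hVr hVr0 hD hzr hnr hEzr hEnr hszr (supported_reflect_Iio (B := Bn)
      (by simpa using hsn)) (hH.trans hTn) hsepn hη hε LN htn
    rw [totalEnergy_reflect hz, totalEnergy_reflect hn] at hpn
    -- (e) the three shares at time `t`
    have hZ' : ENNReal.ofReal c * totalEnergy V z 0
        ≤ farEnergy V (-H) z t + farEnergy (fun x => V (-x)) (-H) (fun t x => z t (-x)) t := by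
      rw [← exteriorEnergy_eq_far_add_reflect hz hat]
      exact SZ.trans (WindowedShellChannels.Negative.channelEnergy_atTop_le_exteriorEnergy hV hV0 hz 0
        (-H) ht0 (by linarith [hat, abs_of_nonneg ht0]))
    have hF' : ENNReal.ofReal cF * totalEnergy V f 0 ≤ farEnergy V (-H) f t :=
      SF.trans (farChannelEnergy_le_farEnergy hV.continuous hV0 hf (-H) ht0)
    have hN' : ENNReal.ofReal cN * totalEnergy V n 0
        ≤ farEnergy (fun x => V (-x)) (-H) (fun t x => n t (-x)) t :=
      SN.trans (farChannelEnergy_le_farEnergy hVr.continuous hVr0 hnr (-H) ht0)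
    -- (f) combine
    calc X ≤ (farEnergy V (-H) z t + farEnergy (fun x => V (-x)) (-H) (fun t x => z t (-x)) t)
          + farEnergy V (-H) f t + farEnergy (fun x => V (-x)) (-H) (fun t x => n t (-x)) t := by
          rw [hX]; gcongr
      _ = (farEnergy V (-H) f t + farEnergy V (-H) z t)
          + (farEnergy (fun x => V (-x)) (-H) (fun t x => n t (-x)) t
            + farEnergy (fun x => V (-x)) (-H) (fun t x => z t (-x)) t) := by ring
      _ ≤ (farEnergy V (-H) (fun t x => z t x + f t x) t + ENNReal.ofReal η * totalEnergy V f 0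
            + ENNReal.ofReal (ε / η) * totalEnergy V z 0)
          + (farEnergy (fun x => V (-x)) (-H) (fun t x => z t (-x) + n t (-x)) t
            + ENNReal.ofReal η * totalEnergy V n 0 + ENNReal.ofReal (ε / η) * totalEnergy V z 0) :=
          add_le_add hpf hpn
      _ = exteriorEnergy V 0 (-H) A t + S := by
          rw [hsplitA, hfarA, hfarAr, hS]; ring
  -- Step 3: real arithmetic
  have hchA : channelEnergy V 0 (-H) A atTop ≠ ⊤ :=
    ne_top_of_le_ne_top hEAfin ((WindowedShellChannels.Negative.channelEnergy_atTop_le_exteriorEnergy hV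
      hV0 hAsol 0 (-H) hH (by simp)).trans
      ((exteriorEnergy_le_totalEnergy V 0 (-H) A H).trans (RW.totalEnergy_le_totalEnergy hV hV0 hAsol H 0)))
  have hchψ : channelEnergy V 0 (-H) ψ atTop ≠ ⊤ :=
    ne_top_of_le_ne_top hEψ ((WindowedShellChannels.Negative.channelEnergy_atTop_le_exteriorEnergy hV
      hV0 hψ 0 (-H) hH (by simp)).trans
      ((exteriorEnergy_le_totalEnergy V 0 (-H) ψ H).trans (RW.totalEnergy_le_totalEnergy hV hV0 hψ H 0)))
  have hchg : channelEnergy V 0 (-H) g atTop ≠ ⊤ :=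
    ne_top_of_le_ne_top hEg ((WindowedShellChannels.Negative.channelEnergy_atTop_le_exteriorEnergy hV
      hV0 hg 0 (-H) hH (by simp)).trans
      ((exteriorEnergy_le_totalEnergy V 0 (-H) g H).trans (RW.totalEnergy_le_totalEnergy hV hV0 hg H 0)))
  obtain ⟨E, n0, eE⟩ : ∃ E : ℝ, 0 ≤ E ∧ totalEnergy V ψ 0 = ENNReal.ofReal E :=
    ⟨_, ENNReal.toReal_nonneg, (ENNReal.ofReal_toReal hEψ).symm⟩
  obtain ⟨Ez, n1, eEz⟩ : ∃ E : ℝ, 0 ≤ E ∧ totalEnergy V z 0 = ENNReal.ofReal E :=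
    ⟨_, ENNReal.toReal_nonneg, (ENNReal.ofReal_toReal hEz).symm⟩
  obtain ⟨En, n2, eEn⟩ : ∃ E : ℝ, 0 ≤ E ∧ totalEnergy V n 0 = ENNReal.ofReal E :=
    ⟨_, ENNReal.toReal_nonneg, (ENNReal.ofReal_toReal hEn).symm⟩
  obtain ⟨Ef, n3, eEf⟩ : ∃ E : ℝ, 0 ≤ E ∧ totalEnergy V f 0 = ENNReal.ofReal E :=
    ⟨_, ENNReal.toReal_nonneg, (ENNReal.ofReal_toReal hEf).symm⟩
  obtain ⟨Eg, n4, eEg⟩ : ∃ E : ℝ, 0 ≤ E ∧ totalEnergy V g 0 = ENNReal.ofReal E :=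
    ⟨_, ENNReal.toReal_nonneg, (ENNReal.ofReal_toReal hEg).symm⟩
  obtain ⟨chψ, n5, echψ⟩ : ∃ E : ℝ, 0 ≤ E ∧ channelEnergy V 0 (-H) ψ atTop = ENNReal.ofReal E :=
    ⟨_, ENNReal.toReal_nonneg, (ENNReal.ofReal_toReal hchψ).symm⟩
  obtain ⟨chA, n6, echA⟩ : ∃ E : ℝ, 0 ≤ E ∧ channelEnergy V 0 (-H) A atTop = ENNReal.ofReal E :=
    ⟨_, ENNReal.toReal_nonneg, (ENNReal.ofReal_toReal hchA).symm⟩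
  obtain ⟨chg, n7, echg⟩ : ∃ E : ℝ, 0 ≤ E ∧ channelEnergy V 0 (-H) g atTop = ENNReal.ofReal E :=
    ⟨_, ENNReal.toReal_nonneg, (ENNReal.ofReal_toReal hchg).symm⟩
  have hη1 : 0 ≤ 1 + η := by linarith
  have hη2 : 0 ≤ 1 + η⁻¹ := by positivity
  have hεη : 0 ≤ ε / η := by positivity
  -- (I) in reals
  have hI' : E + (1 + η⁻¹) * chg + (1 + η) * chA ≤ chψ + (1 + η⁻¹) * Eg + (1 + η) * (Ez + En + Ef) := by
    have h := hI
    rw [hEA, eE, eEz, eEn, eEf, eEg, echψ, echA, echg, ← ENNReal.ofReal_add n1 n2,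
      ← ENNReal.ofReal_add (by positivity) n3, ← ENNReal.ofReal_mul hη1, ← ENNReal.ofReal_mul hη2,
      ← ENNReal.ofReal_mul hη1, ← ENNReal.ofReal_mul hη2,
      ← ENNReal.ofReal_add (by positivity) (by positivity),
      ← ENNReal.ofReal_add (by positivity) (by positivity),
      ← ENNReal.ofReal_add (by positivity) (by positivity),
      ← ENNReal.ofReal_add (by positivity) (by positivity),
      ENNReal.ofReal_le_ofReal_iff (by positivity)] at h
    exact h
  -- (II) in reals
  have hII' : c * Ez + cF * Ef + cN * En ≤ chA + (η * Ef + ε / η * Ez + (η * En + ε / η * Ez)) := by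
    have h := hII
    rw [hX, hS, eEz, eEn, eEf, echA, ← ENNReal.ofReal_mul hc, ← ENNReal.ofReal_mul hcF,
      ← ENNReal.ofReal_mul hcN, ← ENNReal.ofReal_mul hη.le, ← ENNReal.ofReal_mul hεη,
      ← ENNReal.ofReal_mul hη.le,
      ← ENNReal.ofReal_add (by positivity) (by positivity),
      ← ENNReal.ofReal_add (by positivity) (by positivity),
      ← ENNReal.ofReal_add (by positivity) (by positivity),
      ← ENNReal.ofReal_add (by positivity) (by positivity),
      ← ENNReal.ofReal_add (by positivity) (by positivity),
      ← ENNReal.ofReal_add (by positivity) (by positivity),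
      ENNReal.ofReal_le_ofReal_iff (by positivity)] at h
    exact h
  -- (III) in reals
  have hIII : Ez + En + Ef ≤ (1 + δ) * E := by
    have h := hEsum
    rw [eEz, eEn, eEf, eE, ← ENNReal.ofReal_add n1 n2, ← ENNReal.ofReal_add (by positivity) n3,
      ← ENNReal.ofReal_mul (by positivity), ENNReal.ofReal_le_ofReal_iff (by positivity)] at h
    exact h
  have hIV : Eg ≤ δ * E := by
    have h := hEg'
    rw [eEg, eE, ← ENNReal.ofReal_mul hδ, ENNReal.ofReal_le_ofReal_iff (by positivity)] at h
    exact h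
  -- the target in reals
  obtain ⟨m, hm⟩ : ∃ m : ℝ, m = min c (min cF cN) := ⟨_, rfl⟩
  have hmc : m ≤ c := by rw [hm]; exact min_le_left _ _
  have hmF : m ≤ cF := by rw [hm]; exact (min_le_right _ _).trans (min_le_left _ _)
  have hmN : m ≤ cN := by rw [hm]; exact (min_le_right _ _).trans (min_le_right _ _)
  rw [← hm]
  obtain ⟨EA, hEA'⟩ : ∃ EA : ℝ, EA = Ez + En + Ef := ⟨_, rfl⟩
  rw [← hEA'] at hI' hIII
  have key : (1 - (1 + η) * ((1 - m) + η + 2 * ε / η) * (1 + δ) - (1 + η⁻¹) * δ) * E ≤ chψ := by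
    obtain ⟨K, hK⟩ : ∃ K : ℝ, K = (1 - m) + η + 2 * ε / η := ⟨_, rfl⟩
    rw [← hK]
    have hK0 : 0 ≤ K := by
      have : 0 ≤ 2 * ε / η := by positivity
      rw [hK]; linarith only [this, hmc, hc1, hη]
    -- s1: the shares dominate `m·EA`
    have s1 : m * EA ≤ c * Ez + cF * Ef + cN * En := by
      have a1 := mul_le_mul_of_nonneg_right hmc n1
      have a2 := mul_le_mul_of_nonneg_right hmF n3
      have a3 := mul_le_mul_of_nonneg_right hmN n2
      have e1 : m * EA = m * Ez + m * En + m * Ef := by rw [hEA']; ring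
      linarith only [a1, a2, a3, e1]
    -- s2: the interference cost is at most `(η + 2ε/η)·EA`
    have s2 : η * Ef + ε / η * Ez + (η * En + ε / η * Ez) ≤ (η + 2 * ε / η) * EA := by
      have e2 : (η + 2 * ε / η) * EA = η * Ez + η * En + η * Ef + ε / η * Ez + ε / η * Ez
          + 2 * (ε / η) * En + 2 * (ε / η) * Ef := by rw [hEA']; ring
      have b1 : 0 ≤ η * Ez := mul_nonneg hη.le n1
      have b2 : 0 ≤ 2 * (ε / η) * En := by positivity
      have b3 : 0 ≤ 2 * (ε / η) * Ef := by positivity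
      linarith only [e2, b1, b2, b3]
    -- s3: `chA ≥ EA − K·EA`
    have s3 : EA - K * EA ≤ chA := by
      have e3 : EA - K * EA = m * EA - (η + 2 * ε / η) * EA := by rw [hK]; ring
      linarith only [e3, s1, s2, hII']
    have s8 : (1 + η) * EA - (1 + η) * (K * EA) ≤ (1 + η) * chA := by
      have h := mul_le_mul_of_nonneg_left s3 hη1
      rwa [mul_sub] at h
    -- s6: `K·EA ≤ K(1+δ)E`
    have s6 : (1 + η) * (K * EA) ≤ (1 + η) * (K * ((1 + δ) * E)) :=
      mul_le_mul_of_nonneg_left (mul_le_mul_of_nonneg_left hIII hK0) hη1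
    have s7 : (1 + η⁻¹) * Eg ≤ (1 + η⁻¹) * (δ * E) := mul_le_mul_of_nonneg_left hIV hη2
    have s9 : 0 ≤ (1 + η⁻¹) * chg := mul_nonneg hη2 n7
    have goal_eq : (1 - (1 + η) * K * (1 + δ) - (1 + η⁻¹) * δ) * E
        = E - (1 + η) * (K * ((1 + δ) * E)) - (1 + η⁻¹) * (δ * E) := by ring
    rw [goal_eq]
    linarith only [hI', s8, s6, s7, s9]
  -- back to `ℝ≥0∞`
  by_cases hκ : (1 - (1 + η) * ((1 - m) + η + 2 * ε / η) * (1 + δ) - (1 + η⁻¹) * δ) ≤ 0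
  · rw [ENNReal.ofReal_of_nonpos hκ, zero_mul]; exact zero_le
  · push Not at hκ
    rw [eE, echψ, ← ENNReal.ofReal_mul hκ.le]
    exact ENNReal.ofReal_le_ofReal key

end Glue

end Summit.FinalStateConjecture.FinalStateConjecture.Theorems.WindowedShellChannelsSketch

end
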